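import Mathlib.Combinatorics.SimpleGraph.Walk.Operations
import Mathlib.Combinatorics.SimpleGraph.Connectivity.Connected
import HarnessLib

/-!
# Separating connected sets are totally ordered by exteriority (planarity-free), proved

Topic `Literature/Combinatorics/SimpleGraph`. In a simple graph `G` fix two vertex sets `In`
("inside") and `Out` ("outside"). A vertex set `C` SEPARATES them if every walk from `In` to `Out`
has a vertex in `C`; `C` is OUTSIDE `C'` if some vertex of `C` is joined to `Out` by a walk avoiding
`C'`. For pairwise disjoint, internally connected, separating sets this relation is a strict total
order as soon as `In` and `Out` are joined at all:

* `exists_first_mem_walk`, `exists_last_mem_walk` — the first / last vertex of a walk in a set,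
  with the initial / final piece avoiding the set otherwise;
* `not_outside_and_outside` — asymmetry: `C` outside `C'` and `C'` outside `C` is impossible;
* `outside_or_outside` — totality: the last of `C ∪ C'` met by an `In → Out` walk is outside the
  other;
* `outside_trans` — transitivity (a 3-cycle would contradict asymmetry at the last of the three
  sets met by an `In → Out` walk).

Hence among the separating open clusters of an annulus there is an OUTERMOST one — the first step
of Kesten's decomposition at the outermost open circuit (H. Kesten, PTRF 73 (1986), proof of Thm. 3)
— without any planarity: only the definition of separation and connectivity are used. (The planar
input of such decompositions is elsewhere: that the outer face of the outermost cluster is wired from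
outside.) Everything is proved; no definitions (the three notions are written out as hypotheses).

## References

* H. Kesten, *The incipient infinite cluster in two-dimensional percolation*, Probab. Theory Related
  Fields 73 (1986) 369–394, §2 (outermost open circuits).
* G. Grimmett, *Percolation*, 2nd ed., Springer (1999), §11.7 (circuits in annuli) — `Grimmett1999`.
-/

namespace Literature.Combinatorics.SimpleGraph.SeparatingSets

open _root_.SimpleGraph

variable {V : Type*} {G : SimpleGraph V}

/-! ### First and last visits of a walk to a set -/

/-- **First vertex of a walk in a set.** If a walk from `u` to `v` has a vertex in `S`, then some
`z ∈ S` is joined to `u` by a walk all of whose vertices other than `z` lie outside `S`.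
[folklore] -/
theorem exists_first_mem_walk {u v : V} (w : G.Walk u v) {S : Set V}
    (h : ∃ z ∈ w.support, z ∈ S) :
    ∃ z, z ∈ S ∧ ∃ p : G.Walk u z, ∀ y ∈ p.support, y ∈ S → y = z := by
  induction w with
  | nil =>
    obtain ⟨z, hz, hzS⟩ := h
    rw [Walk.support_nil, List.mem_singleton] at hz
    subst hz
    exact ⟨_, hzS, Walk.nil, fun y hy _ => by simpa using hy⟩
  | @cons a b c hab q ih =>
    by_cases ha : a ∈ S
    · exact ⟨a, ha, Walk.nil, fun y hy _ => by simpa using hy⟩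
    · have h' : ∃ z ∈ q.support, z ∈ S := by
        obtain ⟨z, hz, hzS⟩ := h
        rw [Walk.support_cons, List.mem_cons] at hz
        rcases hz with rfl | hz
        · exact absurd hzS ha
        · exact ⟨z, hz, hzS⟩
      obtain ⟨z, hzS, p, hp⟩ := ih h'
      refine ⟨z, hzS, Walk.cons hab p, fun y hy hyS => ?_⟩
      rw [Walk.support_cons, List.mem_cons] at hy
      rcases hy with rfl | hy
      · exact absurd hyS ha
      · exact hp y hy hyS

/-- **Last vertex of a walk in a set.** If a walk from `u` to `v` has a vertex in `S`, then some
`z ∈ S` is joined to `v` by a walk all of whose vertices other than `z` lie outside `S`.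
[folklore] -/
theorem exists_last_mem_walk {u v : V} (w : G.Walk u v) {S : Set V}
    (h : ∃ z ∈ w.support, z ∈ S) :
    ∃ z, z ∈ S ∧ ∃ p : G.Walk z v, ∀ y ∈ p.support, y ∈ S → y = z := by
  have h' : ∃ z ∈ w.reverse.support, z ∈ S := by
    obtain ⟨z, hz, hzS⟩ := h
    exact ⟨z, by rwa [Walk.support_reverse, List.mem_reverse], hzS⟩
  obtain ⟨z, hzS, p, hp⟩ := exists_first_mem_walk w.reverse h'
  refine ⟨z, hzS, p.reverse, fun y hy hyS => hp y ?_ hyS⟩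
  rwa [Walk.support_reverse, List.mem_reverse] at hy

/-! ### Exteriority of separating sets -/

section Order

variable (In Out : Set V)

/-- **Asymmetry.** Let `C`, `C'` be disjoint vertex sets, each internally connected (any two of its
vertices are joined by a walk inside it) and each separating `In` from `Out` (every `In → Out` walk
meets it), and let `In` be joined to `Out`. Then `C` and `C'` cannot both reach `Out` avoiding the
other: an `In → Out` walk first meets `C ∪ C'` at, say, `C`; continuing inside `C` and then to `Out`
avoiding `C'` would avoid `C'` altogether. [cite: Kesten1986, §2] -/
theorem not_outside_and_outside {C C' : Set V}
    (hsep : ∀ ⦃u⦄, u ∈ In → ∀ ⦃v⦄, v ∈ Out → ∀ w : G.Walk u v, ∃ z ∈ w.support, z ∈ C)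
    (hsep' : ∀ ⦃u⦄, u ∈ In → ∀ ⦃v⦄, v ∈ Out → ∀ w : G.Walk u v, ∃ z ∈ w.support, z ∈ C')
    (hconn : ∀ a ∈ C, ∀ b ∈ C, ∃ w : G.Walk a b, ∀ z ∈ w.support, z ∈ C)
    (hconn' : ∀ a ∈ C', ∀ b ∈ C', ∃ w : G.Walk a b, ∀ z ∈ w.support, z ∈ C')
    (hdisj : Disjoint C C') (hIO : ∃ u ∈ In, ∃ v ∈ Out, G.Reachable u v) :
    ¬ ((∃ a ∈ C, ∃ v ∈ Out, ∃ w : G.Walk a v, ∀ z ∈ w.support, z ∉ C') ∧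
       (∃ a ∈ C', ∃ v ∈ Out, ∃ w : G.Walk a v, ∀ z ∈ w.support, z ∉ C)) := by
  rintro ⟨⟨a, haC, v, hv, q, hq⟩, ⟨a', haC', v', hv', q', hq'⟩⟩
  obtain ⟨u₀, hu₀, v₀, hv₀, ⟨w₀⟩⟩ := hIO
  -- the first vertex of `w₀` in `C ∪ C'`
  have hmeet : ∃ z ∈ w₀.support, z ∈ C ∪ C' := by
    obtain ⟨z, hz, hzC⟩ := hsep hu₀ hv₀ w₀
    exact ⟨z, hz, Or.inl hzC⟩
  obtain ⟨z, hzCC', p, hp⟩ := exists_first_mem_walk w₀ hmeet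
  rcases hzCC' with hzC | hzC'
  · -- `In → z ∈ C → a ∈ C → Out`, avoiding `C'`
    obtain ⟨m, hm⟩ := hconn z hzC a haC
    obtain ⟨y, hy, hyC'⟩ := hsep' hu₀ hv ((p.append m).append q)
    rw [Walk.support_append, List.mem_append] at hy
    rcases hy with hy | hy
    · rw [Walk.support_append, List.mem_append] at hy
      rcases hy with hy | hy
      · have := hp y hy (Or.inr hyC')
        subst this
        exact hdisj.le_bot ⟨hzC, hyC'⟩
      · exact hdisj.le_bot ⟨hm y (List.tail_subset _ hy), hyC'⟩
    · exact hq y (List.tail_subset _ hy) hyC'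
  · obtain ⟨m, hm⟩ := hconn' z hzC' a' haC'
    obtain ⟨y, hy, hyC⟩ := hsep hu₀ hv' ((p.append m).append q')
    rw [Walk.support_append, List.mem_append] at hy
    rcases hy with hy | hy
    · rw [Walk.support_append, List.mem_append] at hy
      rcases hy with hy | hy
      · have := hp y hy (Or.inl hyC)
        subst this
        exact hdisj.le_bot ⟨hyC, hzC'⟩
      · exact hdisj.le_bot ⟨hyC, hm y (List.tail_subset _ hy)⟩
    · exact hq' y (List.tail_subset _ hy) hyC

/-- **Totality.** If `C` separates `In` from `Out`, `C ∩ C' = ∅`, and `In` is joined to `Out`,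
then `C` reaches `Out` avoiding `C'` or `C'` reaches `Out` avoiding `C`: the LAST vertex in
`C ∪ C'` of an `In → Out` walk witnesses one of the two. [cite: Kesten1986, §2] -/
theorem outside_or_outside {C C' : Set V}
    (hsep : ∀ ⦃u⦄, u ∈ In → ∀ ⦃v⦄, v ∈ Out → ∀ w : G.Walk u v, ∃ z ∈ w.support, z ∈ C)
    (hdisj : Disjoint C C') (hIO : ∃ u ∈ In, ∃ v ∈ Out, G.Reachable u v) :
    (∃ a ∈ C, ∃ v ∈ Out, ∃ w : G.Walk a v, ∀ z ∈ w.support, z ∉ C') ∨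
    (∃ a ∈ C', ∃ v ∈ Out, ∃ w : G.Walk a v, ∀ z ∈ w.support, z ∉ C) := by
  obtain ⟨u₀, hu₀, v₀, hv₀, ⟨w₀⟩⟩ := hIO
  have hmeet : ∃ z ∈ w₀.support, z ∈ C ∪ C' := by
    obtain ⟨z, hz, hzC⟩ := hsep hu₀ hv₀ w₀
    exact ⟨z, hz, Or.inl hzC⟩
  obtain ⟨z, hzCC', p, hp⟩ := exists_last_mem_walk w₀ hmeet
  rcases hzCC' with hzC | hzC'
  · refine Or.inl ⟨z, hzC, v₀, hv₀, p, fun y hy hyC' => ?_⟩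
    have := hp y hy (Or.inr hyC')
    subst this
    exact hdisj.le_bot ⟨hzC, hyC'⟩
  · refine Or.inr ⟨z, hzC', v₀, hv₀, p, fun y hy hyC => ?_⟩
    have := hp y hy (Or.inl hyC)
    subst this
    exact hdisj.le_bot ⟨hyC, hzC'⟩

/-- **Transitivity.** For three pairwise disjoint, internally connected sets separating `In` from
`Out` (with `In` joined to `Out`): if `C₁` reaches `Out` avoiding `C₂` and `C₂` reaches `Out`
avoiding `C₃`, then `C₁` reaches `Out` avoiding `C₃`. The last of the three met by an `In → Out`
walk reaches `Out` avoiding the other two; if it is `C₁` we are done, otherwise asymmetry is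
violated. With `not_outside_and_outside` and `outside_or_outside`: exteriority is a strict total
order on such sets, so a finite family has an OUTERMOST member. [cite: Kesten1986, §2] -/
theorem outside_trans {C₁ C₂ C₃ : Set V}
    (hsep₁ : ∀ ⦃u⦄, u ∈ In → ∀ ⦃v⦄, v ∈ Out → ∀ w : G.Walk u v, ∃ z ∈ w.support, z ∈ C₁)
    (hsep₂ : ∀ ⦃u⦄, u ∈ In → ∀ ⦃v⦄, v ∈ Out → ∀ w : G.Walk u v, ∃ z ∈ w.support, z ∈ C₂)
    (hsep₃ : ∀ ⦃u⦄, u ∈ In → ∀ ⦃v⦄, v ∈ Out → ∀ w : G.Walk u v, ∃ z ∈ w.support, z ∈ C₃)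
    (hconn₁ : ∀ a ∈ C₁, ∀ b ∈ C₁, ∃ w : G.Walk a b, ∀ z ∈ w.support, z ∈ C₁)
    (hconn₂ : ∀ a ∈ C₂, ∀ b ∈ C₂, ∃ w : G.Walk a b, ∀ z ∈ w.support, z ∈ C₂)
    (hconn₃ : ∀ a ∈ C₃, ∀ b ∈ C₃, ∃ w : G.Walk a b, ∀ z ∈ w.support, z ∈ C₃)
    (h₁₂ : Disjoint C₁ C₂) (h₂₃ : Disjoint C₂ C₃) (h₁₃ : Disjoint C₁ C₃)
    (hIO : ∃ u ∈ In, ∃ v ∈ Out, G.Reachable u v)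
    (H₁₂ : ∃ a ∈ C₁, ∃ v ∈ Out, ∃ w : G.Walk a v, ∀ z ∈ w.support, z ∉ C₂)
    (H₂₃ : ∃ a ∈ C₂, ∃ v ∈ Out, ∃ w : G.Walk a v, ∀ z ∈ w.support, z ∉ C₃) :
    ∃ a ∈ C₁, ∃ v ∈ Out, ∃ w : G.Walk a v, ∀ z ∈ w.support, z ∉ C₃ := by
  obtain ⟨u₀, hu₀, v₀, hv₀, ⟨w₀⟩⟩ := id hIO
  have hmeet : ∃ z ∈ w₀.support, z ∈ C₁ ∪ (C₂ ∪ C₃) := by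
    obtain ⟨z, hz, hzC⟩ := hsep₁ hu₀ hv₀ w₀
    exact ⟨z, hz, Or.inl hzC⟩
  obtain ⟨z, hz, p, hp⟩ := exists_last_mem_walk w₀ hmeet
  rcases hz with hz₁ | hz₂ | hz₃
  · -- the last set met is `C₁`: its tail avoids `C₃`
    refine ⟨z, hz₁, v₀, hv₀, p, fun y hy hy₃ => ?_⟩
    have := hp y hy (Or.inr (Or.inr hy₃))
    subst this
    exact h₁₃.le_bot ⟨hz₁, hy₃⟩
  · -- the last set met is `C₂`: then `C₂` is outside `C₁`, contradicting `H₁₂`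
    exfalso
    refine not_outside_and_outside In Out hsep₁ hsep₂ hconn₁ hconn₂ h₁₂ hIO ⟨H₁₂, ?_⟩
    refine ⟨z, hz₂, v₀, hv₀, p, fun y hy hy₁ => ?_⟩
    have := hp y hy (Or.inl hy₁)
    subst this
    exact h₁₂.le_bot ⟨hy₁, hz₂⟩
  · -- the last set met is `C₃`: then `C₃` is outside `C₂`, contradicting `H₂₃`
    exfalso
    refine not_outside_and_outside In Out hsep₂ hsep₃ hconn₂ hconn₃ h₂₃ hIO ⟨H₂₃, ?_⟩
    refine ⟨z, hz₃, v₀, hv₀, p, fun y hy hy₂ => ?_⟩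
    have := hp y hy (Or.inr (Or.inl hy₂))
    subst this
    exact h₂₃.le_bot ⟨hy₂, hz₃⟩

end Order

end Literature.Combinatorics.SimpleGraph.SeparatingSets
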